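import Literature.NumberTheory.ModularForms.PoincareSeriesWeightTwoRowClasses
import Literature.NumberTheory.ModularForms.PoincareSeriesWeightTwoHeckeLimit
import Mathlib.Analysis.SpecialFunctions.Integrals.Basic
import HarnessLib

/-!
# The Fourier modes of the weight-2 Hecke–Poincaré series of `Γ₀(N)` along a horocycle
# (Iwaniec–Kowalski Lemma 14.2, proof, at `k = 2` with Hecke's factor)

Topic `Literature/NumberTheory/ModularForms` (namespace `Literature.NumberTheory.ModularForms.PoincareWeightTwo`,
continuing `PoincareSeriesWeightTwoHecke.lean` (definitions), `…HeckeConvergence.lean` (T1),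
`…RowClasses.lean` (rows `c = 0`, `d = d₀ + cℓ`, regrouping), `…ModeIntegral.lean` (the cell integral)
and `…HeckeLimit.lean` (`cellTerm`)). One definition with body (`rowMode`, the contribution of one row
to a Fourier mode) and THEOREMS; no named fact.

The theorem `heckeFourierModes` is the registered stub **T2 `stub_heckeFourierModes : HeckeFourierModes`**
of the I1 skeleton `Summits/Parity/GeneralizedHardyLittlewood/Cruxes/PeterssonBoundPrinted/Lines/poincare_hecke.lean`
(Kowalski–Michel 2000, Petersson's formula at prime level and weight 2, stmt-Parity-20404), VERBATIM:
for `N, m ≥ 1`, `s > 0`, `n ∈ ℤ`, `y > 0`,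

  `∫₀¹ P_m(x+iy, s) e(−nx) dx = δ_{mn} e^{−2πmy} + Σ_{r ≥ 1} (Nr)^{−2−2s} S(m,n;Nr) I_s(m/(Nr)², n; y)`,

the `r`-series converging absolutely. Proof (Iwaniec–Kowalski §14.2 / Iwaniec §3.2): integrate the
absolutely convergent row sum termwise (`hasSum_rowMode`); the rows `±(0,1)` give `δ_{mn}e^{−2πmy}`
(`rowMode_of_apply_zero_eq_zero`); the rows `±(c, d₀ + cℓ)`, `ℓ ∈ ℤ`, unfold the period integral to
`∫_ℝ` (`hasSum_rowMode_classRow`), where the shift `t ↦ t − d₀/c` and `γz = a/c − 1/(c(cz+d₀))`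
produce `c^{−2−2s} e((m a + n d₀)/c) I_s(m/c², n; y)` (`integral_poincareTerm_mul_cexp`), and the sum
over `d₀ ∈ (ℤ/cℤ)ˣ`, `a = d₀⁻¹`, is the Kloosterman sum (`sum_rowPhase_eq_kloostermanSum`).

## References

* [IwaniecKowalski2004] H. Iwaniec, E. Kowalski, *Analytic Number Theory*, AMS Colloq. Publ. 53,
  §14.2, proof of Lemma 14.2 (the computation leading to (14.13)), §3.2.
* [Iwaniec2002] H. Iwaniec, *Spectral Methods of Automorphic Forms*, §3.2 (the same unfolding, (3.17)).
-/

noncomputable section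

open scoped MatrixGroups Real Topology
open CongruenceSubgroup Complex MeasureTheory Filter Set
open UpperHalfPlane hiding I
open Literature.NumberTheory.LFunctions (kloostermanSum)

namespace Literature.NumberTheory.ModularForms.PoincareWeightTwo

variable {N : ℕ}

/-! ## The horocycle `x ↦ x + iy` -/

/-- The point `x + iy` of `ℍ`. [folklore] -/
private def hp (x : ℝ) {y : ℝ} (hy : 0 < y) : ℍ := ⟨(x : ℂ) + y * I, by simp [hy]⟩

/-- The underlying complex number of `hp x hy`. [folklore] -/
private theorem hp_coe (x : ℝ) {y : ℝ} (hy : 0 < y) : ((hp x hy : ℍ) : ℂ) = (x : ℂ) + y * I := rfl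

/-- `ofComplex (x + iy) = hp x hy`. [folklore] -/
private theorem ofComplex_eq_hp (x : ℝ) {y : ℝ} (hy : 0 < y) :
    UpperHalfPlane.ofComplex ((x : ℂ) + y * I) = hp x hy :=
  UpperHalfPlane.ofComplex_apply_of_im_pos (by simp [hy])

/-- Translation along the horocycle: `ℓ +ᵥ (x + iy) = (x + ℓ) + iy`. [folklore] -/
private theorem vadd_hp (ℓ x : ℝ) {y : ℝ} (hy : 0 < y) : ((ℓ +ᵥ hp x hy : ℍ)) = hp (x + ℓ) hy := by
  ext1
  rw [UpperHalfPlane.coe_vadd, hp_coe, hp_coe]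
  push_cast; ring

/-- `x + iy` lies in the vertical strip `|Re| ≤ R`, `Im ≥ y` when `|x| ≤ R`. [folklore] -/
private theorem hp_mem_verticalStrip {y : ℝ} (hy : 0 < y) {R x : ℝ} (hx : |x| ≤ R) :
    hp x hy ∈ verticalStrip R y := by
  rw [mem_verticalStrip_iff]
  exact ⟨by simpa [hp, UpperHalfPlane.re] using hx, by simp [hp, UpperHalfPlane.im]⟩

/-- One term of the series is continuous along the horocycle. [cite: IwaniecKowalski2004, §14.1 (14.4)] -/
private theorem continuous_poincareTerm_hp (m : ℕ) (s : ℝ) (v : Row N) {y : ℝ} (hy : 0 < y) :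
    Continuous fun x : ℝ ↦ poincareTerm N m s v (hp x hy) := by
  have hden : Continuous fun x : ℝ ↦ rowDenom v.1 (hp x hy) := by
    unfold rowDenom; simp only [hp_coe]; fun_prop
  have hne : ∀ x : ℝ, rowDenom v.1 (hp x hy) ≠ 0 := fun x ↦ rowDenom_ne_zero v.1 v.2.1 _
  unfold poincareTerm
  refine ((Continuous.inv₀ (hden.pow 2) fun x ↦ pow_ne_zero 2 (hne x)).mul ?_).mul ?_
  · exact Complex.continuous_ofReal.comp
      ((continuous_norm.comp hden).rpow_const fun x ↦ Or.inl (norm_ne_zero_iff.mpr (hne x)))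
  · refine Complex.continuous_exp.comp (continuous_const.mul ?_)
    have hnum : Continuous fun x : ℝ ↦
        ((rowMatrix v.1 v.2.1 0 0 : ℤ) : ℂ) * ((hp x hy : ℍ) : ℂ) + ((rowMatrix v.1 v.2.1 0 1 : ℤ) : ℂ) := by
      simp only [hp_coe]; fun_prop
    have hden' : Continuous fun x : ℝ ↦
        ((rowMatrix v.1 v.2.1 1 0 : ℤ) : ℂ) * ((hp x hy : ℍ) : ℂ) + ((rowMatrix v.1 v.2.1 1 1 : ℤ) : ℂ) := by
      simp only [hp_coe]; fun_prop
    have hne' : ∀ x : ℝ,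
        ((rowMatrix v.1 v.2.1 1 0 : ℤ) : ℂ) * ((hp x hy : ℍ) : ℂ) + ((rowMatrix v.1 v.2.1 1 1 : ℤ) : ℂ) ≠ 0 := by
      intro x
      have := hne x
      simpa [rowDenom, rowMatrix_apply_one_zero, rowMatrix_apply_one_one] using this
    refine (hnum.div hden' hne').congr fun x ↦ ?_
    rw [UpperHalfPlane.coe_specialLinearGroup_apply]
    simp

/-- **Uniform majorant on the segment**: for `|x| ≤ 1`,
`‖term_v(x+iy)‖ ≤ r(1,y)^{−(2+2s)} ‖v‖^{−(2+2s)}` (Eisenstein majorant on the vertical strip).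
[cite: IwaniecKowalski2004, §14.1 (14.4)–(14.5)] -/
private theorem norm_poincareTerm_hp_le (m : ℕ) {s : ℝ} (hs : 0 < s) (v : Row N) {y : ℝ} (hy : 0 < y)
    {x : ℝ} (hx : |x| ≤ 1) :
    ‖poincareTerm N m s v (hp x hy)‖ ≤
      EisensteinSeries.r ⟨⟨1, y⟩, hy⟩ ^ (-(2 + 2 * s)) * ‖v.1‖ ^ (-(2 + 2 * s)) := by
  refine (norm_poincareTerm_le m s v _).trans ?_
  have h := EisensteinSeries.summand_bound_of_mem_verticalStrip (by linarith : (0 : ℝ) ≤ 2 + 2 * s) v.1 hy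
    (hp_mem_verticalStrip hy hx)
  simpa [rowDenom] using h

/-- The majorant is summable over the rows. [cite: IwaniecKowalski2004, §14.1 (14.5)] -/
private theorem summable_majorant {s : ℝ} (hs : 0 < s) {y : ℝ} (hy : 0 < y) :
    Summable fun v : Row N ↦
      EisensteinSeries.r ⟨⟨1, y⟩, hy⟩ ^ (-(2 + 2 * s)) * ‖v.1‖ ^ (-(2 + 2 * s)) := by
  have h := (EisensteinSeries.summable_one_div_norm_rpow (by linarith : 2 < 2 + 2 * s)).mul_left
    (EisensteinSeries.r ⟨⟨1, y⟩, hy⟩ ^ (-(2 + 2 * s)))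
  exact h.subtype _

/-! ## The mode of one row -/

/-- The contribution of the row `v` to the `n`-th Fourier mode along `Im z = y`:
`∫₀¹ (c(x+iy)+d)⁻² |c(x+iy)+d|^{−2s} e(m γ_v(x+iy)) e(−nx) dx`.
[cite: IwaniecKowalski2004, §14.2 (proof of Lemma 14.2)] -/
def rowMode (N : ℕ) (m : ℕ) (s : ℝ) (n : ℤ) (y : ℝ) (v : Row N) : ℂ :=
  ∫ x in (0 : ℝ)..1, poincareTerm N m s v (UpperHalfPlane.ofComplex ((x : ℂ) + y * I)) *
    cexp (-(2 * π * I * n * x))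

/-- `rowMode` along the horocycle `hp`. [cite: IwaniecKowalski2004, §14.2 (proof of Lemma 14.2)] -/
private theorem rowMode_eq (m : ℕ) (s : ℝ) (n : ℤ) {y : ℝ} (hy : 0 < y) (v : Row N) :
    rowMode N m s n y v =
      ∫ x in (0 : ℝ)..1, poincareTerm N m s v (hp x hy) * cexp (-(2 * π * I * n * x)) := by
  unfold rowMode
  refine intervalIntegral.integral_congr fun x _ ↦ ?_
  simp only [ofComplex_eq_hp x hy]

/-- `|e(−nx)| = 1`. [folklore] -/
private theorem norm_cexp_neg_mode (n : ℤ) (x : ℝ) : ‖cexp (-(2 * π * I * n * x))‖ = 1 := by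
  rw [show (-(2 * π * I * n * x) : ℂ) = ((-(2 * π * n * x) : ℝ) : ℂ) * I by push_cast; ring,
    Complex.norm_exp_ofReal_mul_I]

/-- **The size of a row mode**: `‖rowMode v‖ ≤ r(1,y)^{−(2+2s)} ‖v‖^{−(2+2s)}` (`s > 0`).
[cite: IwaniecKowalski2004, §14.2 (proof of Lemma 14.2)] -/
theorem norm_rowMode_le (m : ℕ) {s : ℝ} (hs : 0 < s) (n : ℤ) {y : ℝ} (hy : 0 < y) (v : Row N) :
    ‖rowMode N m s n y v‖ ≤ EisensteinSeries.r ⟨⟨1, y⟩, hy⟩ ^ (-(2 + 2 * s)) * ‖v.1‖ ^ (-(2 + 2 * s)) := by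
  rw [rowMode_eq m s n hy]
  have h := intervalIntegral.norm_integral_le_of_norm_le_const (a := (0 : ℝ)) (b := 1)
    (C := EisensteinSeries.r ⟨⟨1, y⟩, hy⟩ ^ (-(2 + 2 * s)) * ‖v.1‖ ^ (-(2 + 2 * s)))
    (f := fun x : ℝ ↦ poincareTerm N m s v (hp x hy) * cexp (-(2 * π * I * n * x))) ?_
  · simpa using h
  · intro x hx
    rw [Set.uIoc_of_le zero_le_one] at hx
    rw [norm_mul, norm_cexp_neg_mode, mul_one]
    exact norm_poincareTerm_hp_le m hs v hy (abs_le.mpr ⟨by linarith [hx.1], hx.2⟩)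

/-- **The row modes are absolutely summable.** [cite: IwaniecKowalski2004, §14.2 (proof of Lemma 14.2)] -/
theorem summable_norm_rowMode [NeZero N] (m : ℕ) {s : ℝ} (hs : 0 < s) (n : ℤ) {y : ℝ} (hy : 0 < y) :
    Summable fun v : Row N ↦ ‖rowMode N m s n y v‖ :=
  (summable_majorant hs hy).of_nonneg_of_le (fun _ ↦ norm_nonneg _) (norm_rowMode_le m hs n hy)

/-- The row mode is even in the row. [cite: IwaniecKowalski2004, §14.2 (proof of Lemma 14.2)] -/
theorem rowMode_negRow (m : ℕ) (s : ℝ) (n : ℤ) (y : ℝ) (v : Row N) :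
    rowMode N m s n y (negRow v) = rowMode N m s n y v := by
  unfold rowMode
  simp_rw [poincareTerm_negRow]

/-- **Termwise integration of the row sum**: `∫₀¹ P_m(x+iy,s) e(−nx) dx = Σ_v ½ · rowMode v`
(dominated convergence on `[0,1]` with the uniform Eisenstein majorant).
[cite: IwaniecKowalski2004, §14.2 (proof of Lemma 14.2)] -/
theorem hasSum_rowMode [NeZero N] (m : ℕ) {s : ℝ} (hs : 0 < s) (n : ℤ) {y : ℝ} (hy : 0 < y) :
    HasSum (fun v : Row N ↦ (1 / 2 : ℂ) * rowMode N m s n y v)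
      (∫ x in (0 : ℝ)..1, poincareHecke N m s (UpperHalfPlane.ofComplex ((x : ℂ) + y * I)) *
        cexp (-(2 * π * I * n * x))) := by
  have hrw : ∫ x in (0 : ℝ)..1, poincareHecke N m s (UpperHalfPlane.ofComplex ((x : ℂ) + y * I)) *
      cexp (-(2 * π * I * n * x)) =
      ∫ x in (0 : ℝ)..1, poincareHecke N m s (hp x hy) * cexp (-(2 * π * I * n * x)) :=
    intervalIntegral.integral_congr fun x _ ↦ by simp only [ofComplex_eq_hp x hy]
  rw [hrw]
  simp_rw [rowMode_eq m s n hy, ← intervalIntegral.integral_const_mul]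
  set C : ℝ := EisensteinSeries.r ⟨⟨1, y⟩, hy⟩ ^ (-(2 + 2 * s)) with hC
  refine intervalIntegral.hasSum_integral_of_dominated_convergence
    (bound := fun (v : Row N) (_ : ℝ) ↦ 1 / 2 * (C * ‖v.1‖ ^ (-(2 + 2 * s)))) ?_ ?_ ?_ ?_ ?_
  · intro v
    exact (continuous_const.mul ((continuous_poincareTerm_hp m s v hy).mul
      (by fun_prop : Continuous fun x : ℝ ↦ cexp (-(2 * π * I * n * x))))).aestronglyMeasurable
  · intro v
    refine Eventually.of_forall fun x hx ↦ ?_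
    rw [Set.uIoc_of_le zero_le_one] at hx
    rw [norm_mul, norm_mul, norm_cexp_neg_mode, mul_one, show ‖(1 / 2 : ℂ)‖ = 1 / 2 by norm_num]
    exact mul_le_mul_of_nonneg_left
      (norm_poincareTerm_hp_le m hs v hy (abs_le.mpr ⟨by linarith [hx.1], hx.2⟩)) (by norm_num)
  · exact Eventually.of_forall fun x _ ↦ (summable_majorant hs hy).mul_left _
  · exact intervalIntegrable_const
  · refine Eventually.of_forall fun x _ ↦ ?_
    have h := (hasSum_poincareHecke (N := N) m hs (hp x hy)).mul_right (cexp (-(2 * π * I * n * x)))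
    exact h.congr_fun fun v ↦ by ring

/-! ## The rows with `c = 0` -/

/-- `∫₀¹ e(kx) dx = [k = 0]` for `k ∈ ℤ`. [folklore] -/
private theorem intervalIntegral_cexp_int (k : ℤ) :
    ∫ x in (0 : ℝ)..1, cexp (2 * π * I * k * x) = if k = 0 then 1 else 0 := by
  by_cases hk : k = 0
  · rw [if_pos hk, hk]
    simp only [Int.cast_zero, mul_zero, zero_mul, Complex.exp_zero]
    rw [intervalIntegral.integral_const]
    simp
  · rw [if_neg hk]
    have hc : (2 * π * I * k : ℂ) ≠ 0 := by
      have : (k : ℂ) ≠ 0 := by exact_mod_cast hk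
      have hπ : (π : ℂ) ≠ 0 := by exact_mod_cast Real.pi_ne_zero
      exact mul_ne_zero (mul_ne_zero (mul_ne_zero two_ne_zero hπ) Complex.I_ne_zero) this
    have h := integral_exp_mul_complex (a := 0) (b := 1) hc
    rw [h]
    rw [show (2 * π * I * k * ((1 : ℝ) : ℂ) : ℂ) = (k : ℂ) * (2 * π * I) by push_cast; ring,
      Complex.exp_int_mul_two_pi_mul_I]
    simp

/-- **A row with `c = 0` contributes `δ_{mn} e^{−2πmy}`**: its term is `e(m(x+iy))`, and
`∫₀¹ e((m−n)x) dx = δ_{mn}`. [cite: IwaniecKowalski2004, §14.2 (proof of Lemma 14.2: the term c = 0)] -/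
theorem rowMode_of_apply_zero_eq_zero (m : ℕ) (s : ℝ) (n : ℤ) {y : ℝ} (hy : 0 < y) (v : Row N)
    (h : v.1 0 = 0) :
    rowMode N m s n y v = if n = (m : ℤ) then cexp (-(2 * π * m * y)) else 0 := by
  rw [rowMode_eq m s n hy]
  simp_rw [poincareTerm_of_apply_zero_eq_zero m s v h, hp_coe]
  have hsplit : ∀ x : ℝ, cexp (2 * π * I * m * ((x : ℂ) + y * I)) * cexp (-(2 * π * I * n * x)) =
      cexp (-(2 * π * m * y)) * cexp (2 * π * I * ((m : ℤ) - n : ℤ) * x) := by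
    intro x
    rw [← Complex.exp_add, ← Complex.exp_add]
    congr 1
    push_cast
    linear_combination (2 * π * m * y : ℂ) * Complex.I_sq
  simp_rw [hsplit]
  rw [intervalIntegral.integral_const_mul, intervalIntegral_cexp_int]
  by_cases hnm : n = (m : ℤ)
  · rw [if_pos hnm, if_pos (by omega), mul_one]
  · rw [if_neg hnm, if_neg (by omega), mul_zero]

/-! ## One row with `c > 0`: the shift `t ↦ t − d/c` -/

/-- The integrand of the cell integral `I_s(A, B; y)` at the real point `w`. [cite: IwaniecKowalski2004, §14.2 (proof of Lemma 14.2)] -/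
private def modeIntegrand (s A B y w : ℝ) : ℂ :=
  (((w : ℂ) + y * I) ^ 2)⁻¹ * ((‖(w : ℂ) + y * I‖ ^ (-(2 * s)) : ℝ) : ℂ) *
    cexp (2 * π * I * (-(A : ℂ) / ((w : ℂ) + y * I) - B * w))

/-- `modeIntegral s A B y = ∫ modeIntegrand`. [cite: IwaniecKowalski2004, §14.2 (proof of Lemma 14.2)] -/
private theorem modeIntegral_eq (s A B y : ℝ) :
    modeIntegral s A B y = ∫ w : ℝ, modeIntegrand s A B y w := rfl

/-- The phase factor `(c²)⁻¹ c^{−2s} e((m a + n d)/c)` of the row `(c, d)`, `a = (γ_{(c,d)})₀₀`.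
[cite: IwaniecKowalski2004, §14.2 (proof of Lemma 14.2)] -/
def rowPhase (N : ℕ) (m : ℕ) (s : ℝ) (n : ℤ) (v : Row N) : ℂ :=
  (((v.1 0 : ℤ) : ℂ) ^ 2)⁻¹ * ((((v.1 0 : ℤ) : ℝ) ^ (-(2 * s)) : ℝ) : ℂ) *
    cexp (2 * π * I * (((m : ℤ) * rowMatrix v.1 v.2.1 0 0 + n * v.1 1 : ℤ) : ℂ) / ((v.1 0 : ℤ) : ℂ))

/-- **The shift `t ↦ t − d/c` on one row with `c > 0`**: with `W = (t + d/c) + iy`, `cW = c(t+iy) + d`,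
and `γ_{(c,d)}(t+iy) = a/c − 1/(c²W)`, the term times the character is
`(c²)⁻¹ c^{−2s} e((ma + nd)/c) · [W⁻² |W|^{−2s} e(−(m/c²)/W − n(t + d/c))]`.
[cite: IwaniecKowalski2004, §14.2 (proof of Lemma 14.2)] -/
theorem poincareTerm_hp_mul_cexp (m : ℕ) (s : ℝ) (n : ℤ) {y : ℝ} (hy : 0 < y) (v : Row N)
    (hc : 0 < v.1 0) (t : ℝ) :
    poincareTerm N m s v (UpperHalfPlane.ofComplex ((t : ℂ) + y * I)) * cexp (-(2 * π * I * n * t)) =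
      rowPhase N m s n v *
        modeIntegrand s ((m : ℝ) / ((v.1 0 : ℤ) : ℝ) ^ 2) n y (t + ((v.1 1 : ℤ) : ℝ) / ((v.1 0 : ℤ) : ℝ)) := by
  rw [ofComplex_eq_hp t hy]
  have hc0 : v.1 0 ≠ 0 := hc.ne'
  have hcR : (0 : ℝ) < ((v.1 0 : ℤ) : ℝ) := by exact_mod_cast hc
  have hcC : ((v.1 0 : ℤ) : ℂ) ≠ 0 := by exact_mod_cast hc0
  set c : ℝ := ((v.1 0 : ℤ) : ℝ) with hcdef
  set d : ℝ := ((v.1 1 : ℤ) : ℝ) with hddef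
  -- `W = (t + d/c) + iy` and `cW = c(t + iy) + d = j_v(t + iy)`
  set W : ℂ := (((t + d / c : ℝ)) : ℂ) + y * I with hW
  have hWne : W ≠ 0 := by
    intro h0; have := congrArg Complex.im h0; simp [hW, hy.ne'] at this
  have hJ : rowDenom v.1 (hp t hy) = (c : ℂ) * W := by
    rw [rowDenom, hp_coe, hW, hcdef, hddef]
    push_cast
    field_simp
    ring
  have hcCr : (c : ℂ) ≠ 0 := Complex.ofReal_ne_zero.mpr hcR.ne'
  -- the Möbius action
  have hγ : ((rowMatrix v.1 v.2.1 • hp t hy : ℍ) : ℂ) =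
      ((rowMatrix v.1 v.2.1 0 0 : ℤ) : ℂ) / (c : ℂ) - 1 / ((c : ℂ) * ((c : ℂ) * W)) := by
    rw [coe_rowMatrix_smul v hc0, hJ, hcdef]; push_cast; ring
  unfold poincareTerm rowPhase modeIntegrand
  rw [hγ, hJ]
  -- norms and powers
  have hnormcW : ‖(c : ℂ) * W‖ = c * ‖W‖ := by
    rw [norm_mul, Complex.norm_real, Real.norm_of_nonneg hcR.le]
  have hrpow : (c * ‖W‖) ^ (-(2 * s)) = c ^ (-(2 * s)) * ‖W‖ ^ (-(2 * s)) :=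
    Real.mul_rpow hcR.le (norm_nonneg _)
  rw [hnormcW, hrpow]
  have hWt : ((t + d / c : ℝ) : ℂ) + y * I = W := by rw [hW]
  rw [hWt]
  -- collect the exponentials
  rw [show ∀ A B C D : ℂ, A * B * cexp C * cexp D = A * B * (cexp C * cexp D) from fun _ _ _ _ ↦ by ring,
    ← Complex.exp_add]
  rw [show ∀ A B C D E F : ℂ, A * B * cexp C * (D * E * cexp F) = (A * B * D * E) * (cexp C * cexp F)
      from fun _ _ _ _ _ _ ↦ by ring, ← Complex.exp_add]
  have hcast : (((v.1 0 : ℤ) : ℝ) : ℂ) = ((v.1 0 : ℤ) : ℂ) := by push_cast; ring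
  congr 1
  · rw [hcdef]; push_cast; field_simp
  · congr 1
    rw [hcdef, hddef]; push_cast
    field_simp
    ring

/-- The cell integrand is continuous. [cite: IwaniecKowalski2004, §14.2 (proof of Lemma 14.2)] -/
private theorem continuous_modeIntegrand' (s A B : ℝ) {y : ℝ} (hy : 0 < y) :
    Continuous (modeIntegrand s A B y) := continuous_modeIntegrand s A B hy

/-- The cell integrand is integrable for `s ≥ 0`, `A ≥ 0`: `‖·‖ ≤ y^{−2s}(w²+y²)⁻¹`.
[cite: IwaniecKowalski2004, §14.2 (proof of Lemma 14.2)] -/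
private theorem integrable_modeIntegrand {s A y : ℝ} (hs : 0 ≤ s) (hA : 0 ≤ A) (hy : 0 < y) (B : ℝ) :
    Integrable (modeIntegrand s A B y) := by
  refine Integrable.mono' ((Literature.Analysis.SpecialFunctions.integrable_inv_sq_add_sq_of_ne_zero'
    hy.ne').const_mul (y ^ (-(2 * s)))) (continuous_modeIntegrand' s A B hy).aestronglyMeasurable
    (Eventually.of_forall fun w ↦ ?_)
  have hWim : 0 < ((w : ℂ) + y * I).im := by simp [hy]
  have hnorm : ‖(w : ℂ) + y * I‖ ^ 2 = w ^ 2 + y ^ 2 := by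
    rw [Complex.sq_norm, Complex.normSq_add_mul_I]
  have hyle : y ≤ ‖(w : ℂ) + y * I‖ := by simpa using Complex.im_le_norm ((w : ℂ) + y * I)
  have h1 : ‖(((w : ℂ) + y * I) ^ 2)⁻¹‖ = (w ^ 2 + y ^ 2)⁻¹ := by rw [norm_inv, norm_pow, hnorm]
  have h2 : ‖(((‖(w : ℂ) + y * I‖ ^ (-(2 * s)) : ℝ) : ℂ))‖ ≤ y ^ (-(2 * s)) := by
    rw [Complex.norm_real, Real.norm_of_nonneg (Real.rpow_nonneg (norm_nonneg _) _)]
    exact Real.rpow_le_rpow_of_nonpos hy hyle (by linarith)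
  have h3 : ‖cexp (2 * π * I * (-(A : ℂ) / ((w : ℂ) + y * I) - B * w))‖ ≤ 1 := by
    have hsplit : cexp (2 * π * I * (-(A : ℂ) / ((w : ℂ) + y * I) - B * w)) =
        cexp (2 * π * I * (-(A : ℂ) / ((w : ℂ) + y * I))) * cexp (((-(2 * π * B * w)) : ℝ) * I) := by
      rw [← Complex.exp_add]; congr 1; push_cast; ring
    rw [hsplit, norm_mul, Complex.norm_exp_ofReal_mul_I, mul_one, Complex.norm_exp, Real.exp_le_one_iff]
    have him : (-(A : ℂ) / ((w : ℂ) + y * I)).im = A * ((w : ℂ) + y * I).im / Complex.normSq ((w : ℂ) + y * I) := by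
      rw [Complex.div_im]; simp; ring
    have hre : (2 * π * I * (-(A : ℂ) / ((w : ℂ) + y * I))).re = -(2 * π) * (-(A : ℂ) / ((w : ℂ) + y * I)).im := by
      simp [Complex.mul_re]
    rw [hre, him]
    have hn : 0 < Complex.normSq ((w : ℂ) + y * I) := Complex.normSq_pos.mpr (by
      intro h; rw [h] at hWim; simp at hWim)
    have : 0 ≤ A * ((w : ℂ) + y * I).im / Complex.normSq ((w : ℂ) + y * I) := by positivity
    nlinarith [Real.pi_pos]
  unfold modeIntegrand
  rw [norm_mul, norm_mul, h1]
  calc (w ^ 2 + y ^ 2)⁻¹ * ‖(((‖(w : ℂ) + y * I‖ ^ (-(2 * s)) : ℝ) : ℂ))‖ *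
        ‖cexp (2 * π * I * (-(A : ℂ) / ((w : ℂ) + y * I) - B * w))‖
      ≤ (w ^ 2 + y ^ 2)⁻¹ * y ^ (-(2 * s)) * 1 := by gcongr
    _ = y ^ (-(2 * s)) * (w ^ 2 + y ^ 2)⁻¹ := by ring

/-- **The integral over `ℝ` of one row with `c > 0`**:
`∫_ℝ term_v(t+iy) e(−nt) dt = (c²)⁻¹ c^{−2s} e((ma+nd)/c) · I_s(m/c², n; y)`, with the integrand
integrable. [cite: IwaniecKowalski2004, §14.2 (proof of Lemma 14.2)] -/
theorem integral_poincareTerm_mul_cexp (m : ℕ) {s : ℝ} (hs : 0 ≤ s) (n : ℤ) {y : ℝ} (hy : 0 < y)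
    (v : Row N) (hc : 0 < v.1 0) :
    Integrable (fun t : ℝ ↦ poincareTerm N m s v (UpperHalfPlane.ofComplex ((t : ℂ) + y * I)) *
      cexp (-(2 * π * I * n * t))) ∧
    ∫ t : ℝ, poincareTerm N m s v (UpperHalfPlane.ofComplex ((t : ℂ) + y * I)) *
        cexp (-(2 * π * I * n * t)) =
      rowPhase N m s n v * modeIntegral s ((m : ℝ) / ((v.1 0 : ℤ) : ℝ) ^ 2) n y := by
  have hA : 0 ≤ (m : ℝ) / ((v.1 0 : ℤ) : ℝ) ^ 2 := by positivity
  have hG := integrable_modeIntegrand hs hA hy n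
  set δ : ℝ := ((v.1 1 : ℤ) : ℝ) / ((v.1 0 : ℤ) : ℝ) with hδ
  have hpt : (fun t : ℝ ↦ poincareTerm N m s v (UpperHalfPlane.ofComplex ((t : ℂ) + y * I)) *
      cexp (-(2 * π * I * n * t))) =
      fun t : ℝ ↦ rowPhase N m s n v * modeIntegrand s ((m : ℝ) / ((v.1 0 : ℤ) : ℝ) ^ 2) n y (t + δ) :=
    funext fun t ↦ poincareTerm_hp_mul_cexp m s n hy v hc t
  rw [hpt]
  refine ⟨(hG.comp_add_right δ).const_mul _, ?_⟩
  rw [integral_const_mul, modeIntegral_eq]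
  congr 1
  exact integral_add_right_eq_self (μ := volume) (fun w ↦ modeIntegrand s ((m : ℝ) / ((v.1 0 : ℤ) : ℝ) ^ 2) n y w) δ

/-! ## Unfolding the classes `d = d₀ + cℓ` -/

/-- The unfolding `Σ_{ℓ ∈ ℤ} ∫₀¹ F(x + ℓ) dx = ∫_ℝ F` for an integrable `F` (the tree's
`Fuchsian.hasSum_intervalIntegral_comp_add_int`, re-proved here to keep the imports light). [folklore] -/
private theorem hasSum_intervalIntegral_comp_add_int' {F : ℝ → ℂ} (hF : Integrable F) :
    HasSum (fun k : ℤ ↦ ∫ x in (0 : ℝ)..1, F (x + k)) (∫ t : ℝ, F t) := by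
  have hU : (⋃ k : ℤ, Ioc ((0 : ℝ) + k) (0 + k + 1)) = univ := iUnion_Ioc_add_intCast (0 : ℝ)
  have hdisj : Pairwise (Function.onFun Disjoint fun k : ℤ ↦ Ioc ((0 : ℝ) + k) (0 + k + 1)) :=
    pairwise_disjoint_Ioc_add_intCast (0 : ℝ)
  have h := hasSum_integral_iUnion (fun k : ℤ ↦ measurableSet_Ioc) hdisj (by rw [hU]; exact hF.integrableOn)
  rw [hU, Measure.restrict_univ] at h
  refine h.congr_fun fun k ↦ ?_
  simp only [zero_add]
  rw [intervalIntegral.integral_comp_add_right (fun t ↦ F t) (k : ℝ), zero_add, add_comm,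
    intervalIntegral.integral_of_le (by linarith : (k : ℝ) ≤ k + 1)]

/-- **Unfolding one class**: for `c = N(r+1)` and a unit `u` mod `c`,
`Σ_{ℓ ∈ ℤ} rowMode (c, d₀ + cℓ) = ∫_ℝ term_{(c,d₀)}(t+iy) e(−nt) dt = rowPhase (c,d₀) · I_s(m/c², n; y)`.
[cite: IwaniecKowalski2004, §14.2 (proof of Lemma 14.2)] -/
theorem hasSum_rowMode_classRow [NeZero N] (m : ℕ) {s : ℝ} (hs : 0 ≤ s) (n : ℤ) {y : ℝ} (hy : 0 < y)
    (r : ℕ) (u : (ZMod (cMod N r))ˣ) :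
    HasSum (fun ℓ : ℤ ↦ rowMode N m s n y (classRow N r u ℓ))
      (rowPhase N m s n (classRow N r u 0) *
        modeIntegral s ((m : ℝ) / (((classRow N r u 0).1 0 : ℤ) : ℝ) ^ 2) n y) := by
  obtain ⟨hint, hval⟩ := integral_poincareTerm_mul_cexp m hs n hy (classRow N r u 0)
    (classRow_apply_zero_pos r u 0)
  rw [← hval]
  have h := hasSum_intervalIntegral_comp_add_int' hint
  refine h.congr_fun fun ℓ ↦ ?_
  rw [rowMode_eq m s n hy]
  refine intervalIntegral.integral_congr fun x _ ↦ ?_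
  rw [ofComplex_eq_hp _ hy, poincareTerm_classRow, vadd_hp]
  congr 1
  rw [show (-(2 * π * I * n * ((x + ℓ : ℝ) : ℂ)) : ℂ) = -(2 * π * I * n * x) + ((-(n * ℓ) : ℤ) : ℂ) * (2 * π * I)
    by push_cast; ring, Complex.exp_add, Complex.exp_int_mul_two_pi_mul_I, mul_one]

/-! ## The Kloosterman sum -/

/-- **The phases of the classes mod `c` add up to the Kloosterman sum**:
`Σ_{u ∈ (ℤ/cℤ)ˣ} rowPhase (c, d₀(u)) = (c²)⁻¹ c^{−2s} S(m, n; c)` (`a = d₀⁻¹ (mod c)`).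
[cite: IwaniecKowalski2004, §14.2 (proof of Lemma 14.2)] [cite: Iwaniec2002, §2.5 (2.23)] -/
theorem sum_rowPhase_eq [NeZero N] (m : ℕ) (s : ℝ) (n : ℤ) (r : ℕ) :
    ∑ u : (ZMod (cMod N r))ˣ, rowPhase N m s n (classRow N r u 0) =
      haveI := neZero_cMod N r
      (((cMod N r : ℕ) : ℂ) ^ 2)⁻¹ * ((((cMod N r : ℕ) : ℝ) ^ (-(2 * s)) : ℝ) : ℂ) *
        kloostermanSum (cMod N r) ((m : ℤ) : ZMod (cMod N r)) ((n : ℤ) : ZMod (cMod N r)) := by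
  classical
  haveI := neZero_cMod N r
  -- each phase is `(c²)⁻¹ c^{-2s} χ(m u⁻¹ + n u)`
  have hterm : ∀ u : (ZMod (cMod N r))ˣ, rowPhase N m s n (classRow N r u 0) =
      (((cMod N r : ℕ) : ℂ) ^ 2)⁻¹ * ((((cMod N r : ℕ) : ℝ) ^ (-(2 * s)) : ℝ) : ℂ) *
        ZMod.stdAddChar (((m : ℤ) : ZMod (cMod N r)) * ((u⁻¹ : (ZMod (cMod N r))ˣ) : ZMod (cMod N r)) +
          ((n : ℤ) : ZMod (cMod N r)) * (u : ZMod (cMod N r))) := by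
    intro u
    unfold rowPhase
    simp only [classRow_apply_zero, classRow_apply_one, mul_zero, add_zero]
    rw [show ((((cMod N r : ℕ) : ℤ) : ℂ)) = ((cMod N r : ℕ) : ℂ) by push_cast; ring,
      show ((((cMod N r : ℕ) : ℤ) : ℝ)) = ((cMod N r : ℕ) : ℝ) by push_cast; ring]
    congr 1
    -- the character: `a = u⁻¹` and `d₀ = u` in `ℤ/cℤ`
    have hmul : (u : ZMod (cMod N r)) *
        ((rowMatrix (classRow N r u 0).1 (classRow N r u 0).2.1 0 0 : ℤ) : ZMod (cMod N r)) = 1 := by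
      rw [mul_comm]; exact rowMatrix_zero_zero_mul_val r u
    have ha : ((rowMatrix (classRow N r u 0).1 (classRow N r u 0).2.1 0 0 : ℤ) : ZMod (cMod N r)) =
        ((u⁻¹ : (ZMod (cMod N r))ˣ) : ZMod (cMod N r)) := by
      rw [← ZMod.inv_coe_unit, ZMod.inv_eq_of_mul_eq_one _ _ _ hmul]
    have hcast : (((m : ℤ) * rowMatrix (classRow N r u 0).1 (classRow N r u 0).2.1 0 0 +
        n * ((u : ZMod (cMod N r)).val : ℤ) : ℤ) : ZMod (cMod N r)) =
        ((m : ℤ) : ZMod (cMod N r)) * ((u⁻¹ : (ZMod (cMod N r))ˣ) : ZMod (cMod N r)) +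
          ((n : ℤ) : ZMod (cMod N r)) * (u : ZMod (cMod N r)) := by
      push_cast
      rw [ha, ZMod.natCast_zmod_val]
    rw [← hcast, ZMod.stdAddChar_coe]
  rw [Finset.sum_congr rfl fun u _ ↦ hterm u, ← Finset.mul_sum]
  congr 1
  -- reindex the Kloosterman sum by `x = u⁻¹`
  unfold kloostermanSum
  rw [← Finset.sum_filter]
  have hmap : (Finset.univ.filter fun x : ZMod (cMod N r) ↦ IsUnit x) =
      Finset.univ.map ⟨(fun u : (ZMod (cMod N r))ˣ ↦ (u : ZMod (cMod N r))), Units.val_injective⟩ := by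
    ext x
    simp only [Finset.mem_filter, Finset.mem_univ, true_and, Finset.mem_map, Function.Embedding.coeFn_mk]
    constructor
    · rintro ⟨u, rfl⟩; exact ⟨u, rfl⟩
    · rintro ⟨u, rfl⟩; exact u.isUnit
  rw [hmap, Finset.sum_map]
  simp only [Function.Embedding.coeFn_mk]
  refine Fintype.sum_equiv (Equiv.inv (ZMod (cMod N r))ˣ) _ _ fun u ↦ ?_
  simp only [Equiv.inv_apply]
  rw [ZMod.inv_coe_unit, inv_inv]

/-! ## Absolute convergence of the cell series for every `s ≥ 0` -/

/-- **The `r`-series of cells converges absolutely for every `s ≥ 0`** (Weil majorant times the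
`e^{−π|n|y}` bound of the cell integral). [cite: IwaniecKowalski2004, §14.2 (proof of Lemma 14.2)] -/
theorem summable_norm_cellTerm_of_nonneg [NeZero N] {m : ℕ} (hm : 1 ≤ m) {s : ℝ} (hs : 0 ≤ s) (n : ℤ)
    {y : ℝ} (hy : 0 < y) : Summable fun r : ℕ ↦ ‖cellTerm N m s n y r‖ := by
  set K : ℝ := 2 * π / y * (y / 2) ^ (-(2 * s)) * Real.exp (-(π * |(n : ℝ)| * y)) with hK
  refine ((summable_cellMajorant N m).mul_right K).of_nonneg_of_le (fun _ ↦ norm_nonneg _) fun r ↦ ?_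
  rcases eq_or_ne r 0 with rfl | hr
  · simp [cellMajorant]
  rw [cellTerm_of_ne_zero m s n y hr, norm_mul]
  have hA : 0 ≤ (m : ℝ) / ((N * r : ℕ) : ℝ) ^ 2 := by positivity
  exact mul_le_mul (norm_cell_arith_le hm hs n hr) (norm_modeIntegral_le hs hA hy _) (norm_nonneg _)
    (cellMajorant_nonneg m r)

/-! ## The Fourier modes (T2) -/

/-- **T2 of the I1 skeleton `poincare_hecke` (`stub_heckeFourierModes : HeckeFourierModes`), PROVED.**
For `N, m ≥ 1`, `s > 0`, `n ∈ ℤ`, `y > 0`: the `r`-series of cells converges absolutely and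
`∫₀¹ P_m(x+iy, s) e(−nx) dx = δ_{mn} e^{−2πmy} + Σ_{r ≥ 1} (Nr)^{−2−2s} S(m,n;Nr) I_s(m/(Nr)², n; y)`
(termwise integration of the row sum; rows `±(0,1)`; unfolding of the classes `d = d₀ + cℓ`; the
shift `t ↦ t − d₀/c`; Kloosterman sums). [cite: IwaniecKowalski2004, Lemma 14.2 (proof, k = 2 with Hecke's factor)] -/
theorem heckeFourierModes :
    ∀ (N : ℕ) [NeZero N] (m : ℕ), 1 ≤ m → ∀ (s : ℝ), 0 < s → ∀ (n : ℤ) (y : ℝ), 0 < y →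
      Summable (fun r : ℕ ↦ ‖cellTerm N m s n y r‖) ∧
      ∫ x in (0 : ℝ)..1, poincareHecke N m s (UpperHalfPlane.ofComplex ((x : ℂ) + y * I)) *
          cexp (-(2 * π * I * n * x)) =
        (if n = (m : ℤ) then cexp (-(2 * π * m * y)) else 0) + ∑' r : ℕ, cellTerm N m s n y r := by
  intro N _ m hm s hs n y hy
  refine ⟨summable_norm_cellTerm_of_nonneg hm hs.le n hy, ?_⟩
  -- termwise integration and regrouping of the rows
  have hmain := (hasSum_rowMode (N := N) m hs n hy).tsum_eq
  rw [← hmain, tsum_mul_left,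
    tsum_row_eq (summable_norm_rowMode m hs n hy) (rowMode_negRow m s n y),
    rowMode_of_apply_zero_eq_zero m s n hy rowZeroPos rfl,
    rowMode_of_apply_zero_eq_zero m s n hy rowZeroNeg rfl]
  -- each class: unfolding, shift, Kloosterman
  have hclass : ∀ r : ℕ, ∑ u : (ZMod (cMod N r))ˣ, ∑' ℓ : ℤ, rowMode N m s n y (classRow N r u ℓ) =
      cellTerm N m s n y (r + 1) := by
    intro r
    haveI := neZero_cMod N r
    have hℓ : ∀ u : (ZMod (cMod N r))ˣ, ∑' ℓ : ℤ, rowMode N m s n y (classRow N r u ℓ) =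
        rowPhase N m s n (classRow N r u 0) *
          modeIntegral s ((m : ℝ) / ((cMod N r : ℕ) : ℝ) ^ 2) n y := fun u ↦ by
      rw [(hasSum_rowMode_classRow m hs.le n hy r u).tsum_eq, classRow_apply_zero, Int.cast_natCast]
    simp_rw [hℓ]
    rw [← Finset.sum_mul, sum_rowPhase_eq, cellTerm_of_ne_zero m s n y (Nat.succ_ne_zero r)]
  simp_rw [hclass]
  rw [(summable_norm_cellTerm_of_nonneg hm hs.le n hy).of_norm.tsum_eq_zero_add, cellTerm_zero, zero_add]
  ring

end Literature.NumberTheory.ModularForms.PoincareWeightTwo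

end
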